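import Summits.ResolutionOfSingularities.ResolutionOfSingularities.Theorems.PurelyInseparableDim4PointRoots
import Summits.ResolutionOfSingularities.ResolutionOfSingularities.Theorems.PurelyInseparableDim4PointTransport
import HarnessLib

/-!
# Purely inseparable four-folds: termination ⇒ order reduction in the isolated regime with a WALK-LOCAL finiteness
# hypothesis (one-step finiteness of the MODEL at each state) instead of a condition on all admissible sequences
# (brick TY-3k part 5b «POINT TREE, LOCAL FORM», cell `res-dim4-pi`)

[OURS · counted 0] (D-0157 DOOR 2; sharpens parts 3–4 of the finite-tree assembly of `PIDim4.TerminationImpliesOrderReduction`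
(MODE 0, isolated regime); host item stmt-ResolutionOfSingularities-16155, helper). Resolution of singularities in dimension
≥ 4 / characteristic `p` is NOT proved here or anywhere in this programme.

Parts 3–4 assumed the ISOLATED regime in the form «along EVERY admissible blow-up sequence of `M₀` the closed points of
order `≥ p` are finitely many» — a condition on objects the walk never visits. Here it is replaced by a condition on the
STATES of the walk only: ONE-STEP FINITENESS of the MODEL at `s` — the chosen blowing up `B : Bl → 𝔸⁵_K` of the origin
carries only finitely many closed points of order `≥ p` of the `B`-transform of `(z^p + s.F)·𝒪` over the origin — required
HEREDITARILY below the root states (for every state reachable by edges); by `…PointTransport` the closed order-`p`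
points over a blown-up point `x₁` of ANY ambient inject into those of the model over `ξ`.

* **`exists_isMarkedResolution_of_config_local`** — the finite-tree induction (as in part 3) with per-point hereditary
  one-step finiteness in place of the global `hfin`; the new configuration is (survivors = unique preimages of the other
  points, re-charted) ⊔ (points over `x₁`), and the multiset of states moves down in `Relation.CutExpand`;
* **`exists_isMarkedResolution_of_forall_root`** — `K = K̄`, `F ≠ 0` clean, finitely many closed order-`p` points of
  `z^p + F`, and below the re-centred state of each of them the walk is well-founded AND hereditarily one-step finite
  ⇒ `∃ X′ π M′, IsMarkedResolution ⟨hypSheaf p F, [], p⟩ π M′` (the conclusion of `PIDim4.OrderReduction p` for `F`).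

NOT `OrderReduction p`. AI-produced formalisation, weaker than expert review.
bears_on: LADDER-RESOLUTION:D157-DOOR2 (res-dim4-pi · TY-3k).
-/

set_option linter.dupNamespace false -- D-0017: single-problem summit path `Summit.<S>.<S>.…` by design

noncomputable section

open MvPolynomial Finset CategoryTheory AlgebraicGeometry Opposite TopologicalSpace

namespace Summit.ResolutionOfSingularities.ResolutionOfSingularities.Theorems.PIDim4

open Literature.AlgebraicGeometry.Resolution
open Literature.AlgebraicGeometry.Resolution.Hauser2010
open Literature.AlgebraicGeometry.Resolution.AffinePointBlowup (P A γ coord Wtop ξ)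

namespace Equimultiple

/-! ## The finite tree with hereditary one-step finiteness -/

section TreeLocal

variable {K : Type} [Field K] {p : ℕ} [hp : Fact p.Prime] [CharP K p]

/-- **THE FINITE TREE, LOCAL FORM.** As `exists_isMarkedResolution_of_config`, but the isolated-regime hypothesis is
carried by the STATES: every configuration point's state `s` is HEREDITARILY ONE-STEP FINITE — for every state `s′`
reachable from `s` by edges, the chosen blowing up of `𝔸⁵_K` at the origin carries only finitely many closed points of
order `≥ p` of the transform of `(z^p + s′.F)·𝒪` over the origin. One step: blow up `x₁`; the new configuration is the
set of (unique) preimages of the other points together with the finitely many closed order-`p` points over `x₁`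
(`finite_closedOver_of_zigzag`); the multiset of states moves down in `Relation.CutExpand`.
[cite: BierstoneGrigorievMilmanWlodarczyk2011, Def. 3.1.3] [cite: Hauser2010, §F]
[cite: Hironaka1964, Main Theorem I (the characteristic-zero statement whose analogue is asked)] -/
theorem exists_isMarkedResolution_of_config_local {X : Scheme.{0}} [IsLocallyNoetherian X] [JacobsonSpace X]
    [IsAlgClosed K] [DecidableEq K] (M₀ : MarkedIdeal X) (hE : HasSNC M₀.boundary) (hmult : M₀.mult = p)
    (T : Multiset (State K))
    (hT : Acc (Relation.CutExpand (fun s' s : State K => Edge p Finset.univ s s' ∧ s' ≠ s)) T) :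
    ∀ (X' : Scheme.{0}) (σ : X' ⟶ X) (M' : MarkedIdeal X') (_ : IsMultipleBlowup M₀ σ M') (pts : Finset X')
      (st : X' → State K) (_ : pts.val.map st = T) (_ : ∀ x ∈ pts, IsClosed ({x} : Set X'))
      (_ : ∀ z : X', IsClosed ({z} : Set X') → (p : ℕ∞) ≤ idealOrder M'.ideal z → z ∈ pts)
      (_ : ∀ x ∈ pts, (st x).F ≠ 0 ∧
        Literature.Barriers.ResolutionOfSingularities.HauserPerlega.IsClean p (st x).F ∧
        (p : ℕ∞) ≤ CentreBlowup.ordAlong (Finset.univ : Finset (Fin 4)) (st x).F ∧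
        Acc (fun s' s : State K => Edge p Finset.univ s s') (st x) ∧
        (∀ s' : State K, Relation.ReflTransGen (fun a b : State K => Edge p Finset.univ a b) (st x) s' →
          {w' : blowup (Scheme.IdealSheafData.vanishingIdeal (AffinePointBlowup.C₀ 4 K)) |
            IsClosed ({w'} : Set (blowup (Scheme.IdealSheafData.vanishingIdeal (AffinePointBlowup.C₀ 4 K)))) ∧
            blowup.π (Scheme.IdealSheafData.vanishingIdeal (AffinePointBlowup.C₀ 4 K)) w' = ξ 4 K ∧
            (p : ℕ∞) ≤ idealOrder ((⟨hypSheaf p s'.F, [], p⟩ : MarkedIdeal (P 4 K)).transform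
              (blowup.π (Scheme.IdealSheafData.vanishingIdeal (AffinePointBlowup.C₀ 4 K)))
              (Scheme.IdealSheafData.vanishingIdeal (AffinePointBlowup.C₀ 4 K))).ideal w'}.Finite) ∧
        ∃ (Y : Scheme.{0}) (φ : Y ⟶ X') (ψ : Y ⟶ P 4 K) (_ : IsOpenImmersion φ) (_ : IsOpenImmersion ψ) (y : Y),
          φ y = x ∧ ψ y = ξ 4 K ∧ M'.ideal.comap φ = (hypSheaf p (st x).F).comap ψ),
      ∃ (X'' : Scheme.{0}) (π : X'' ⟶ X) (M'' : MarkedIdeal X''), IsMarkedResolution M₀ π M'' := by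
  classical
  induction hT with
  | intro T _ ih =>
    intro X' σ M' h pts st hT hclosed hcover hdata
    haveI : IsLocallyNoetherian X' := h.isLocallyNoetherian
    haveI : JacobsonSpace X' := jacobsonSpace_of_isMultipleBlowup h
    have hmult' : M'.mult = p := h.mult_eq.trans hmult
    rcases pts.eq_empty_or_nonempty with hempty | ⟨x₁, hx₁⟩
    · -- no closed point of order `≥ p`: the prefix is already a marked resolution
      have hreg : Scheme.IsRegular X' := fun x => ((h.hasSNC_boundary hE) x).1
      refine ⟨X', σ, M', h, (support_eq_empty_iff_forall_isClosed hreg M').mpr fun w hw => ?_⟩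
      rw [hmult']
      by_contra hge
      rw [not_lt] at hge
      have hmem := hcover w hw hge
      rw [hempty] at hmem
      exact Finset.notMem_empty w hmem
    · -- blow up `x₁`
      obtain ⟨hF₁, hclean₁, hperm₁, hacc₁, hlocfin₁, Y, φ, ψ, _, _, y, hφ, hψ, hM₁⟩ := hdata x₁ hx₁
      have hx₁c : IsClosed ({x₁} : Set X') := hclosed x₁ hx₁
      set s₁ : State K := st x₁ with hs₁
      set C := Scheme.IdealSheafData.vanishingIdeal (⟨{x₁}, hx₁c⟩ : Closeds X') with hC
      have hπ : IsBlowup (blowup.π C) C := blowup.isBlowup C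
      have h₁ : IsMultipleBlowup M₀ (blowup.π C ≫ σ) (M'.transform (blowup.π C) C) :=
        isMultipleBlowup_extend_point_of_zigzag h hE hmult φ ψ y hx₁c hφ hψ s₁ hM₁ hperm₁ hπ
      haveI : IsLocallyNoetherian (blowup C) := h₁.isLocallyNoetherian
      set M'' := M'.transform (blowup.π C) C with hM''
      have hM''I : M''.ideal = controlledTransform (blowup.π C) C M'.ideal M'.mult := rfl
      have hsuppC : ∀ z : X', z ∉ (C.support : Set X') ↔ z ≠ x₁ := fun z =>
        not_congr (mem_support_vanishingIdeal_singleton_iff hx₁c)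
      -- the step package at the closed order-`p` points over `x₁`
      have pkg : ∀ w : blowup C, IsClosed ({w} : Set (blowup C)) → blowup.π C w = x₁ →
          (p : ℕ∞) ≤ idealOrder M''.ideal w →
          ∃ (j : Fin 4) (b : Fin 4 → K), b j = 0 ∧ Edge p Finset.univ s₁ (CentreBlowup.step p Finset.univ j b s₁) ∧
            ∃ (Y' : Scheme.{0}) (φ' : Y' ⟶ blowup C) (ψ' : Y' ⟶ P 4 K) (_ : IsOpenImmersion φ')
              (_ : IsOpenImmersion ψ') (y' : Y'), φ' y' = w ∧ ψ' y' = ξ 4 K ∧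
              M''.ideal.comap φ' = (hypSheaf p (CentreBlowup.step p Finset.univ j b s₁).F).comap ψ' :=
        fun w hw hwx hord =>
          zigzag_step_package φ ψ y hx₁c hφ hψ M' hmult' s₁ hM₁ hF₁ hclean₁ hperm₁ hπ hw hwx hord
      -- the points over `x₁`: finitely many (one-step finiteness of the model at `s₁`)
      have hoverfin := finite_closedOver_of_zigzag φ ψ y hx₁c hφ hψ M' hmult' s₁ hM₁ hπ
        (hlocfin₁ s₁ Relation.ReflTransGen.refl)
      set ov : Finset (blowup C) := hoverfin.toFinset with hov_def
      have hmem_over : ∀ w : blowup C, w ∈ ov ↔ IsClosed ({w} : Set (blowup C)) ∧ blowup.π C w = x₁ ∧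
          (p : ℕ∞) ≤ idealOrder M''.ideal w := fun w => by
        rw [hov_def, Set.Finite.mem_toFinset, Set.mem_setOf_eq]
      -- the survivors: the unique preimages of the other configuration points
      have hpre : ∀ z : {z // z ∈ pts.erase x₁}, ∃ w : blowup C, blowup.π C w = z.1 := fun z =>
        exists_eq_of_not_mem_support hπ ((hsuppC z.1).mpr (Finset.mem_erase.mp z.2).1)
      set pre : {z // z ∈ pts.erase x₁} → blowup C := fun z => (hpre z).choose with hpre_def
      have hπpre : ∀ z : {z // z ∈ pts.erase x₁}, blowup.π C (pre z) = z.1 := fun z => (hpre z).choose_spec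
      have hpre_inj : Function.Injective pre := by
        intro z z' hzz
        apply Subtype.ext
        rw [← hπpre z, ← hπpre z', hzz]
      set surv : Finset (blowup C) := (pts.erase x₁).attach.image pre with hsurv_def
      have hmem_surv : ∀ w : blowup C, w ∈ surv ↔ blowup.π C w ∈ pts ∧ blowup.π C w ≠ x₁ := by
        intro w
        rw [hsurv_def, Finset.mem_image]
        constructor
        · rintro ⟨z, -, rfl⟩
          rw [hπpre z]
          have hz := Finset.mem_erase.mp z.2
          exact ⟨hz.2, hz.1⟩
        · rintro ⟨hw, hwx⟩
          refine ⟨⟨blowup.π C w, Finset.mem_erase.mpr ⟨hwx, hw⟩⟩, Finset.mem_attach _ _, ?_⟩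
          exact eq_of_eq_of_not_mem_support hπ (hπpre _) (by rw [hπpre]; exact (hsuppC _).mpr hwx)
      have hdisj : Disjoint ov surv := by
        rw [Finset.disjoint_left]
        intro w hw hw'
        exact ((hmem_surv w).mp hw').2 ((hmem_over w).mp hw).2.1
      set pts' : Finset (blowup C) := ov.disjUnion surv hdisj with hpts'
      have hmem' : ∀ w : blowup C, w ∈ pts' ↔ w ∈ ov ∨ w ∈ surv := fun w => Finset.mem_disjUnion
      -- orders and closedness of the survivors
      have hsurv_ord : ∀ w : blowup C, blowup.π C w ≠ x₁ →
          idealOrder M''.ideal w = idealOrder M'.ideal (blowup.π C w) := fun w hwx => by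
        rw [hM''I]
        exact idealOrder_controlledTransform_eq_of_eq_of_not_mem_support hπ ((hsuppC _).mpr hwx) M'.ideal
          M'.mult rfl
      have hsurv_closed : ∀ w ∈ surv, IsClosed ({w} : Set (blowup C)) := by
        intro w hw
        obtain ⟨hz, hzx⟩ := (hmem_surv w).mp hw
        exact isClosed_singleton_of_not_mem_support hπ (hclosed _ hz) ((hsuppC _).mpr hzx)
      -- the new states: edge successors over `x₁`, the old states elsewhere
      set st' : blowup C → State K := fun w =>
        if hc : IsClosed ({w} : Set (blowup C)) ∧ blowup.π C w = x₁ ∧ (p : ℕ∞) ≤ idealOrder M''.ideal w then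
          CentreBlowup.step p Finset.univ (pkg w hc.1 hc.2.1 hc.2.2).choose
            (pkg w hc.1 hc.2.1 hc.2.2).choose_spec.choose s₁
        else st (blowup.π C w) with hst'
      have hover : ∀ w ∈ ov,
          ∃ (j : Fin 4) (b : Fin 4 → K), st' w = CentreBlowup.step p Finset.univ j b s₁ ∧ b j = 0 ∧
            Edge p Finset.univ s₁ (CentreBlowup.step p Finset.univ j b s₁) ∧
            ∃ (Y' : Scheme.{0}) (φ' : Y' ⟶ blowup C) (ψ' : Y' ⟶ P 4 K) (_ : IsOpenImmersion φ')
              (_ : IsOpenImmersion ψ') (y' : Y'), φ' y' = w ∧ ψ' y' = ξ 4 K ∧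
              M''.ideal.comap φ' = (hypSheaf p (CentreBlowup.step p Finset.univ j b s₁).F).comap ψ' := by
        intro w hw
        have hc := (hmem_over w).mp hw
        refine ⟨(pkg w hc.1 hc.2.1 hc.2.2).choose, (pkg w hc.1 hc.2.1 hc.2.2).choose_spec.choose, ?_,
          (pkg w hc.1 hc.2.1 hc.2.2).choose_spec.choose_spec⟩
        rw [hst']
        exact dif_pos hc
      have hoff : ∀ w : blowup C, blowup.π C w ≠ x₁ → st' w = st (blowup.π C w) := by
        intro w hwx
        rw [hst']
        exact dif_neg fun hc => hwx hc.2.1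
      -- multiset bookkeeping
      have hrest : surv.val.map st' = ((pts.erase x₁).val).map st := by
        rw [hsurv_def, Finset.image_val_of_injOn (hpre_inj.injOn), Multiset.map_map, Finset.attach_val]
        conv_rhs => rw [← Multiset.attach_map_val (pts.erase x₁).val, Multiset.map_map]
        refine Multiset.map_congr rfl fun z _ => ?_
        change st' (pre z) = st z.1
        rw [hoff (pre z) (by rw [hπpre]; exact (Finset.mem_erase.mp z.2).1), hπpre]
      have hTsplit : T = s₁ ::ₘ ((pts.erase x₁).val).map st := by
        rw [← hT, ← Multiset.map_cons st x₁, Finset.erase_val, Multiset.cons_erase (Finset.mem_val.mpr hx₁)]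
      have hT'split : pts'.val.map st' = ov.val.map st' + ((pts.erase x₁).val).map st := by
        rw [← hrest, ← Multiset.map_add]
        rfl
      have hcut : Relation.CutExpand (fun s' s : State K => Edge p Finset.univ s s' ∧ s' ≠ s)
          (pts'.val.map st') T := by
        refine ⟨ov.val.map st', s₁, fun a ha => ?_, ?_⟩
        · rw [Multiset.mem_map] at ha
          obtain ⟨w, hw, rfl⟩ := ha
          obtain ⟨j, b, hst'w, -, hedge, -⟩ := hover w (Finset.mem_val.mp hw)
          rw [hst'w]
          exact ⟨hedge, fun he => not_edge_self_of_acc hacc₁ (by rw [he] at hedge; exact hedge)⟩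
        · rw [hT'split, hTsplit, ← Multiset.singleton_add]
          abel
      -- recurse on the new configuration
      refine ih _ hcut (blowup C) (blowup.π C ≫ σ) M'' h₁ pts' st' rfl (fun w hw => ?_) (fun z hz hzo => ?_)
        fun w hw => ?_
      · rcases (hmem' w).mp hw with hw | hw
        · exact ((hmem_over w).mp hw).1
        · exact hsurv_closed w hw
      · rw [hmem']
        by_cases hzx : blowup.π C z = x₁
        · exact Or.inl ((hmem_over z).mpr ⟨hz, hzx, hzo⟩)
        · refine Or.inr ((hmem_surv z).mpr ⟨hcover _ (isClosed_singleton_π' hπ hz) ?_, hzx⟩)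
          rw [← hsurv_ord z hzx]
          exact hzo
      · rcases (hmem' w).mp hw with hw | hw
        · obtain ⟨j, b, hst'w, -, hedge, Y', φ', ψ', _, _, y', hφ', hψ', hM'⟩ := hover w hw
          obtain ⟨j'', b'', -, -, heq'', hF'', hs''⟩ := id hedge
          rw [hst'w]
          refine ⟨by rw [hs'']; exact hF'', isClean_step Finset.univ j b s₁,
            by rw [hs'']; exact ordAlong_univ_step_of_isEquimultiplePoint j'' b'' s₁ heq'', hacc₁.inv hedge,
            fun s' hs' => hlocfin₁ s' (Relation.ReflTransGen.head hedge hs'),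
            Y', φ', ψ', inferInstance, inferInstance, y', hφ', hψ', hM'⟩
        · obtain ⟨hz, hzx⟩ := (hmem_surv w).mp hw
          obtain ⟨hFz, hcleanz, hpermz, haccz, hlocfinz, Yz, φz, ψz, _, _, yz, hφz, hψz, hMz⟩ := hdata _ hz
          have hnot : blowup.π C w ∉ (C.support : Set X') := (hsuppC _).mpr hzx
          obtain ⟨Y', φ', ψ', _, _, y', hφ', hψ', hM'⟩ :=
            exists_zigzag_comap_controlledTransform_of_not_mem_support hπ hnot φz ψz yz hφz hψz M'.ideal
              (hypSheaf p (st (blowup.π C w)).F) hMz M'.mult (w := w) rfl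
          rw [hoff w hzx]
          exact ⟨hFz, hcleanz, hpermz, haccz, hlocfinz, Y', φ', ψ', inferInstance, inferInstance, y', hφ', hψ',
            by rw [hM''I]; exact hM'⟩

/-- **TERMINATION ⇒ ORDER REDUCTION (MODE 0, isolated regime, WALK-LOCAL hypotheses).** `K = K̄` of characteristic `p`,
`F ≠ 0` clean, the closed points of order `≥ p` of `(z^p + F)·𝒪` on `𝔸⁵_K` finitely many. Suppose that below the
re-centred state `s_b = (deletePthPowers p (F(x + b)), 0, ∅)` of every closed order-`p` point `(a, b)` the point-centre
walk is well-founded (`Acc`) and HEREDITARILY ONE-STEP FINITE (every state reachable from `s_b` by edges has only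
finitely many closed order-`p` points over the origin after the chosen blowing up of the origin). Then
`(𝔸⁵_K, (z^p + F)·𝒪, [], p)` admits a marked resolution (BGMW Def. 3.1.3) — the conclusion of `PIDim4.OrderReduction p`
for `F`. NOT `OrderReduction p`. [cite: BierstoneGrigorievMilmanWlodarczyk2011, Def. 3.1.3] [cite: Hauser2010, §§F–G]
[cite: Hironaka1964, Main Theorem I (the characteristic-zero statement whose analogue is asked)] -/
theorem exists_isMarkedResolution_of_forall_root [IsAlgClosed K] [DecidableEq K] (F : MvPolynomial (Fin 4) K)
    (hF : F ≠ 0) (hclean : Literature.Barriers.ResolutionOfSingularities.HauserPerlega.IsClean p F)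
    (hfin₀ : {x : P 4 K | IsClosed ({x} : Set (P 4 K)) ∧ (p : ℕ∞) ≤ idealOrder (hypSheaf p F) x}.Finite)
    (hroot : ∀ (a : K) (b : Fin 4 → K), a ^ p + MvPolynomial.eval b F = 0 →
      (∀ d : Fin 4 →₀ ℕ, d ≠ 0 → d.degree < p → coeff d (PointBlowup.translate b F) = 0) →
      Acc (fun s' s : State K => Edge p Finset.univ s s')
          (⟨deletePthPowers p (PointBlowup.translate b F), 0, ∅⟩ : State K) ∧
        ∀ s' : State K, Relation.ReflTransGen (fun a b : State K => Edge p Finset.univ a b)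
            (⟨deletePthPowers p (PointBlowup.translate b F), 0, ∅⟩ : State K) s' →
          {w' : blowup (Scheme.IdealSheafData.vanishingIdeal (AffinePointBlowup.C₀ 4 K)) |
            IsClosed ({w'} : Set (blowup (Scheme.IdealSheafData.vanishingIdeal (AffinePointBlowup.C₀ 4 K)))) ∧
            blowup.π (Scheme.IdealSheafData.vanishingIdeal (AffinePointBlowup.C₀ 4 K)) w' = ξ 4 K ∧
            (p : ℕ∞) ≤ idealOrder ((⟨hypSheaf p s'.F, [], p⟩ : MarkedIdeal (P 4 K)).transform
              (blowup.π (Scheme.IdealSheafData.vanishingIdeal (AffinePointBlowup.C₀ 4 K)))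
              (Scheme.IdealSheafData.vanishingIdeal (AffinePointBlowup.C₀ 4 K))).ideal w'}.Finite) :
    ∃ (X' : Scheme.{0}) (π : X' ⟶ P 4 K) (M' : MarkedIdeal X'),
      IsMarkedResolution (⟨hypSheaf p F, [], p⟩ : MarkedIdeal (P 4 K)) π M' := by
  classical
  haveI : PerfectRing K p := PerfectRing.ofSurjective K p fun x => IsAlgClosed.exists_pow_nat_eq x hp.out.pos
  set M₀ : MarkedIdeal (P 4 K) := ⟨hypSheaf p F, [], p⟩ with hM₀
  have hE₀ : HasSNC M₀.boundary :=
    hasSNC_nil_of_isRegular (Literature.AlgebraicGeometry.Hironaka2017.Lib.AffinePointBlowupLSB.isRegular_Z 4 K)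
  set pts : Finset (P 4 K) := hfin₀.toFinset with hpts
  have hmem : ∀ x : P 4 K, x ∈ pts ↔ IsClosed ({x} : Set (P 4 K)) ∧ (p : ℕ∞) ≤ idealOrder M₀.ideal x := fun x => by
    rw [hpts, Set.Finite.mem_toFinset, Set.mem_setOf_eq]
  set st : P 4 K → State K := fun x =>
    if hx : IsClosed ({x} : Set (P 4 K)) then
      ⟨deletePthPowers p (PointBlowup.translate (exists_eq_vanishingIdeal_cons_of_isClosed hx).choose_spec.choose F),
        0, ∅⟩
    else ⟨F, 0, ∅⟩ with hst
  have hdata : ∀ x ∈ pts, (st x).F ≠ 0 ∧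
      Literature.Barriers.ResolutionOfSingularities.HauserPerlega.IsClean p (st x).F ∧
      (p : ℕ∞) ≤ CentreBlowup.ordAlong (Finset.univ : Finset (Fin 4)) (st x).F ∧
      Acc (fun s' s : State K => Edge p Finset.univ s s') (st x) ∧
      (∀ s' : State K, Relation.ReflTransGen (fun a b : State K => Edge p Finset.univ a b) (st x) s' →
        {w' : blowup (Scheme.IdealSheafData.vanishingIdeal (AffinePointBlowup.C₀ 4 K)) |
          IsClosed ({w'} : Set (blowup (Scheme.IdealSheafData.vanishingIdeal (AffinePointBlowup.C₀ 4 K)))) ∧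
          blowup.π (Scheme.IdealSheafData.vanishingIdeal (AffinePointBlowup.C₀ 4 K)) w' = ξ 4 K ∧
          (p : ℕ∞) ≤ idealOrder ((⟨hypSheaf p s'.F, [], p⟩ : MarkedIdeal (P 4 K)).transform
            (blowup.π (Scheme.IdealSheafData.vanishingIdeal (AffinePointBlowup.C₀ 4 K)))
            (Scheme.IdealSheafData.vanishingIdeal (AffinePointBlowup.C₀ 4 K))).ideal w'}.Finite) ∧
      ∃ (Y : Scheme.{0}) (φ : Y ⟶ P 4 K) (ψ : Y ⟶ P 4 K) (_ : IsOpenImmersion φ) (_ : IsOpenImmersion ψ) (y : Y),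
        φ y = x ∧ ψ y = ξ 4 K ∧ M₀.ideal.comap φ = (hypSheaf p (st x).F).comap ψ := by
    intro x hx
    obtain ⟨hxc, hord⟩ := (hmem x).mp hx
    set a := (exists_eq_vanishingIdeal_cons_of_isClosed hxc).choose with ha
    set b := (exists_eq_vanishingIdeal_cons_of_isClosed hxc).choose_spec.choose with hb
    have hxab : x.asIdeal = MvPolynomial.vanishingIdeal K {(Fin.cons a b : Fin (4 + 1) → K)} :=
      (exists_eq_vanishingIdeal_cons_of_isClosed hxc).choose_spec.choose_spec
    have hstx : st x = ⟨deletePthPowers p (PointBlowup.translate b F), 0, ∅⟩ := by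
      rw [hst]
      exact dif_pos hxc
    have hord' := (natCast_le_idealOrder_hypSheaf_iff (p := p) F hxab p).mp hord
    rw [natCast_le_ordZero_translate_hyp_iff] at hord'
    obtain ⟨hab, H⟩ := hord'
    obtain ⟨φ, _, hφ, hMφ⟩ := exists_chart_recenter (p := p) F a b hab hxab
    obtain ⟨haccx, hlocx⟩ := hroot a b hab H
    rw [hstx]
    exact ⟨deletePthPowers_translate_ne_zero hF hclean b, isClean_deletePthPowers _,
      ordAlong_univ_deletePthPowers_translate F b H, haccx, hlocx, P 4 K, φ, 𝟙 _, inferInstance, inferInstance,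
      ξ 4 K, hφ, rfl, by rw [Scheme.IdealSheafData.comap_id]; exact hMφ⟩
  haveI : Std.Irrefl (fun s' s : State K => Edge p Finset.univ s s' ∧ s' ≠ s) := ⟨fun s hs => hs.2 rfl⟩
  have hT : Acc (Relation.CutExpand (fun s' s : State K => Edge p Finset.univ s s' ∧ s' ≠ s)) (pts.val.map st) := by
    refine Relation.acc_of_singleton fun s hs => ?_
    rw [Multiset.mem_map] at hs
    obtain ⟨x, hx, rfl⟩ := hs
    exact (Subrelation.accessible (fun hs => hs.1) (hdata x (Finset.mem_val.mp hx)).2.2.2.1).cutExpand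
  exact exists_isMarkedResolution_of_config_local M₀ hE₀ rfl _ hT (P 4 K) (𝟙 _) M₀ (IsMultipleBlowup.refl _) pts st
    rfl (fun x hx => ((hmem x).mp hx).1) (fun z hz hzo => (hmem z).mpr ⟨hz, hzo⟩) hdata

end TreeLocal

end Equimultiple

end Summit.ResolutionOfSingularities.ResolutionOfSingularities.Theorems.PIDim4

end
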